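import Summits.BirchSwinnertonDyer.Rank1Residual.X2.NonsplitBDPValueDisplayRescale
import Summits.BirchSwinnertonDyer.Rank1Residual.X11b.CastellaErratumTwistUnits
import Summits.BirchSwinnertonDyer.Rank1Residual.X11b.HeegnerIdealConverse
import Literature.NumberTheory.EllipticCurves.Castella2018Exceptional.PNewBDPContinuity
import Literature.NumberTheory.EllipticCurves.HeegnerHypothesisKroneckerProofs
import HarnessLib

/-!
# O9 ∩ {non-split} at `p ≥ 5`: the value half c2 FROM PRINT, (R2) in the kernel — BDP 2013's display
# (Castella JIMJ 2018 Thms. 2.10–2.11, Literature fact `thm210_thm211_bdpDisplay_pNew`) IMPLIES the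
# continuous-function display c2-cont (`X2.NonsplitBDPValueContinuousDisplayAt`-shape) by an EXACT
# rescaling to Castella's display with a virtual period (cell `bsd-eis`, seat `bsd-eis-k5-c4`; route
# `EisensteinPrimes`, crux 4 `BSDpOnCellC` = stmt-BirchSwinnertonDyer-19034, line b1, atom c2¬split;
# RULING L11 (O2), k5-c4-MEMO-1 (B2))

HONEST FRAMING (cell `bsd-eis`): theorems only; nothing booked; X2 stays CONSTRUCTION-SHAPED; no label
moves; BSD is not proved by any of this — a closed crux 4 would close the B11 leaf of rung K5 only.

## What this file kernel-checks, and why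

The non-split (b1) road of crux 4 over the wide receptacle `𝓞_{ℂ_p}⟦T⟧` (k5-c4 g0:
`X2/NonsplitBDPExistsInt.lean`, `X2/NonsplitHalvesOnTreeInt.lean`, `X2/NonsplitCellCClassInt.lean`,
`X2/NonsplitHalvesIntRigidity.lean`) reads the ¬split half of crux 4 as PUBLISHED facts + c2♭ + c3♭ +
[crux 3 ∩ ¬split], and `X2/NonsplitHalvesIntRigidity.lean` §3 reduces c2♭ to the CONTINUOUS-FUNCTION
display `X2.NonsplitBDPValueContinuousDisplayAt W p` (one-sided value rigidity across periods). k5-c4 g0's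
MEMO-1 (B2) derived on paper that at `p ≥ 5` this display follows from Castella, JIMJ 17 (2018)
[cas-split] Thm. 2.10 (continuity of `L_𝔭(f)` on BDP's `Σ̂_cc(𝔑)` with the squared interpolation) and
Thm. 2.11 (the value at `𝐍_K`), stated in Bertolini–Darmon–Prasanna 2013's own display — modulo the
reading (R2) «BDP's constants `w(f,χ)⁻¹C(f,χ,1)/Ω^{4n}` vs Castella's `Γ(n)Γ(n+1)/(π^{2n+1}Ω_K^{4n})`
differ by `(const)^n` (absorbed by a virtual period) and a `p`-adic UNIT». The planner's RULING L11
(2026-08-26T07:15:24Z) asked for (R2) IN THE KERNEL, not in a docstring. This file and its lemma file `X2/NonsplitBDPValueDisplayRescale.lean` (§1–§5 there) do exactly that: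

* §1 `PNewDisplay.exists_mul_eq_span_and_isCoprime` — the auxiliary pair `(𝔟, b_N)` of BDP (5.1.6)
  (`𝔟𝔑 = (b_N)`, `𝔟` prime to a given ideal) by the Chinese remainder theorem
  (`ClassGroup.exists_mul_eq_span_and_forall_not_mem`, prime by prime).
* §2 `PNewDisplay.eventually_forall_norm_avatarValueAt_sub_one_lt` — for characters through the
  anticyclotomic `κ`, convergence `r_k(γ) → 1` at a topological generator is UNIFORM convergence
  `r_k → 1` on `Γ_K` (`X11b.Halves.exists_addChar_of_factorsThroughZp`: `r_k` is a continuous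
  character `χ_k` of `ℤ_p` with `χ_k(1) = r_k(γ)`, and `‖χ_k(a) − 1‖ ≤ ‖χ_k(1) − 1‖` on the dense `ℕ`,
  ultrametrically) — the tree's interpolation sequences converge in BDP's topology of `Σ̂_cc(𝔑)`.
* §3 `PNewDisplay.tendsto_symm_heckeIdealValue` — `ι⁻¹(φ_k(𝔟)) → 1` for `𝔟` prime to `p`: at each
  prime `v ∣ 𝔟` an arithmetic Frobenius `Φ_v` has `r_k(Φ_v) = ι⁻¹(φ_k(ϖ_v))⁻¹` (`IsPAdicAvatarOf`, rank
  one, `exists_isArithFrobAt_of_mem_primesAbove_holds`), and `r_k(Φ_v) → 1`; finite product over the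
  factorisation of `𝔟` (`heckeIdealValueExtZero_eq_prod`).
* §4 `PNewDisplay.eulerSq_mul_bdpLalg_eq` — THE RESCALING (B2): `(1 − a_p p⁻¹φ(𝔭))²·L_alg(f,χ⁻¹,0) =
  bdpInterpolationValue p f 𝔭 φ n Ω_K′ · g/(w_f·φ(𝔟))` with `Ω_K′⁴ = Ω⁴·N𝔟·(−N₀)·|d_K|/(4π⁴ b_N²)` and
  `g = (1/4)·w_K·|d_K|^{1/2}·2^{#S(f)}` — every `n`-th power (`π^{4n}`, `(4/|d_K|)^n`,
  `(N𝔟(−N₀)/b_N²)^n`, `(Ω_K′/Ω)^{4n}`) absorbed EXACTLY (BDP Rem. 5.6 / 5.8); `field_simp`.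
* §5 `PNewDisplay.norm_map_natCast_eq_one`, `norm_map_sqrt_discr_eq_one` — `‖ι⁻¹ g‖ = 1` at an odd
  `p ≥ 5` split in `K`: `p ∤ 4·2^{#S}`, `p ∤ w_K` (`X11b.not_dvd_torsionOrder_of_finrank_le_two`),
  `p ∤ d_K` (`SatisfiesHeegnerHypothesis.not_dvd_discr`), so `‖ι⁻¹|d_K|^{1/2}‖² = ‖d_K‖_p = 1`.
* §6 **`continuousDisplay_pNew_of_bdpDisplay`** — the fact `thm210_thm211_bdpDisplay_pNew` IMPLIES, at
  every X2-shaped datum with `5 ≤ p` (the binder list k5-c4 g0 typed as the would-be fact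
  `thm210_thm211_continuousDisplay_pNew`, now a THEOREM): `∃ Ω_K′ ≠ 0, Ω_p ≠ 0, u′, ‖u′‖ = 1` with
  `ι⁻¹(bdpInterpolationValue p f 𝔭 φ_k n_k Ω_K′)·Ω_p^{4n_k} → u′·((1 − a_p p⁻¹)·log_{ω_E} P)²` along every
  sequence through `κ` with `r_k(γ) → 1`; `u′ = u²·ι⁻¹(w_f)/ι⁻¹(g)`.

Consumer: `X2/NonsplitCellCClassIntPNew.lean` (k5-c4): at `p ≥ 5` the ¬split half of crux 4 =
PUBLISHED facts (incl. Hsieh 2014 Thm. 1 and this [cas-split] fact) + c3♭ + [crux 3 ∩ ¬split], c2 GONE.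
At `p = 3` (5 382 non-split B11 cells) c2 stays the typed `NonsplitBDPValueSomeFrameOnTreeInt W 3` (no
value theorem at `3 ‖ N` in print; LZZ18 modulo N1–N3, k5-c4-MEMO-1 (B3)). CONDITIONAL on the cited
fact (readings (R1), (R-top), (R-w), (R3) recorded in its docstring); (R2) is this file's §4–§5.

References: [Castella2018Exceptional] Thms. 2.10–2.11, Prop. 2.7; [BertoliniDarmonPrasanna2013] (4.1.5),
Thm. 4.6, (5.1.6), (5.1.11), Lemma 5.3, Thm. 5.5, Rem. 5.6, §5.2 ((5.2.3)–(5.2.4), Rem. 5.8, Prop. 5.10);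
[Castella2018] Thm. 3.1–3.2, (3.2)–(3.3); [SerreAbelianLadic1968] Ch. II §2.7; [NeukirchANT1999] Ch. I §3.
-/

noncomputable section

namespace Summit.BirchSwinnertonDyer.Rank1Residual.X2

open scoped Classical MatrixGroups ModularForm Topology
open Filter CongruenceSubgroup WeierstrassCurve NumberField IsDedekindDomain Field
open Literature Literature.NumberTheory.EllipticCurves Literature.NumberTheory.GaloisRepresentations
open Literature.NumberTheory.EllipticCurves.ModularForms
open Literature.NumberTheory.EllipticCurves.BertoliniDarmonPrasanna2013
open Literature.NumberTheory.EllipticCurves.Castella2018Exceptional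
open Literature.NumberTheory.EllipticCurves.Castella2018

set_option autoImplicit false

/-! ### §6 The theorem: the BDP display in print ⟹ the continuous-function display c2-cont at `p ≥ 5` -/

section Main

open PNewDisplay

/-- **[cas-split] Thms. 2.10–2.11 in BDP 2013's display (the Literature fact
`Castella2018Exceptional.thm210_thm211_bdpDisplay_pNew`) IMPLY the cell's continuous-function display
at every X2-shaped datum with `5 ≤ p`** — the statement k5-c4 g0 had typed as the would-be fact
`thm210_thm211_continuousDisplay_pNew`, now a THEOREM: there are virtual periods `Ω_K′ ≠ 0`, `Ω_p ≠ 0`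
and `u′ ∈ ℂ_p`, `‖u′‖ = 1`, such that along EVERY interpolation sequence `(φ_k, n_k, r_k)` through the
anticyclotomic `κ` with `r_k(γ) → 1` the Castella displays `ι⁻¹(bdpInterpolationValue p f 𝔭 φ_k n_k
Ω_K′)·Ω_p^{4n_k}` tend to `u′·((1 − a_p p⁻¹)·log_{ω_E} P)²`. Proof (k5-c4-MEMO-1 (B2) in the kernel):
(i) a cyclic ideal `𝔑` of norm `N/p` exists under the Heegner hypothesis
(`X11b.HeegnerIdeal.exists_ideal_quotient_ringEquiv_zmod_of_split_or_ramified`) and an auxiliary pair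
`(𝔟, b_N)`, `𝔟𝔑 = (b_N)`, `(𝔟, N) = 1` by the Chinese remainder theorem
(`exists_mul_eq_span_and_isCoprime`); (ii) the fact supplies `w_f = ±1`, `Ω`, `Ω_p`, `u` and the
convergence of BDP's `L_p(f, φ_k𝐍_K)` along sequences whose avatars converge UNIFORMLY — which the
tree's sequences do (`eventually_forall_norm_avatarValueAt_sub_one_lt`: through `κ`, convergence at
the generator is uniform); (iii) `Ω_K′` is a complex fourth root absorbing every `n`-th power
(`eulerSq_mul_bdpLalg_eq`), so the Castella display equals `L_p(f,φ_k𝐍_K)·ι⁻¹(w_f φ_k(𝔟))/ι⁻¹(g)`,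
`g = (1/4)w_K|d_K|^{1/2}2^{#S(f)}`; (iv) `ι⁻¹(φ_k(𝔟)) → 1` (Frobenius at the primes of `𝔟 ∤ p`,
`tendsto_symm_heckeIdealValue`); (v) `‖ι⁻¹ g‖ = 1`: `p` odd, `p ∤ w_K` (`p ≥ 5`, `[K:ℚ] = 2`),
`p ∤ d_K` (Heegner at `p ∣ N`). So `u′ = u²·ι⁻¹(w_f)/ι⁻¹(g)`. CONDITIONAL on the cited fact only;
X2 CONSTRUCTION-SHAPED; no label change.
[cite: Castella2018Exceptional, Thm. 2.10 and Thm. 2.11 (arXiv:1507.04260 pp. 13–14)]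
[cite: BertoliniDarmonPrasanna2013, Thm. 4.6, (5.1.6), (5.1.11), Thm. 5.5, §5.2 (topology of Σ̂, (5.2.3)–(5.2.4), Rem. 5.8, Prop. 5.10)]
[cite: Castella2018, Thm. 3.2 with (3.2)–(3.3) (arXiv:1704.06608 p. 9)] -/
theorem continuousDisplay_pNew_of_bdpDisplay (hB : thm210_thm211_bdpDisplay_pNew)
    {p : ℕ} [Fact p.Prime] (ι : PadicAlgCl p ≃+* ℂ) (W : WeierstrassCurve ℚ) [W.IsElliptic]
    [W.IsGloballyMinimal] (K : Type) [Field K] [NumberField K] (𝔭 : HeightOneSpectrum (𝓞 K))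
    (κ : ZpExtension K p) (γ : absoluteGaloisGroup K) {N : ℕ} [NeZero N]
    (Dt : ModularParametrizationData W N) (H : HeegnerDatum N (NumberField.discr K))
    (w : InfinitePlace K) (e : K →+* ℚ_[p]) (P : (W.baseChange K).toAffine.Point)
    (hp5 : 5 ≤ p) (hWN : W.conductorNorm ℤ = N) (hpN : p ∣ N) (hp2N : ¬ p ^ 2 ∣ N)
    (hK : IsImaginaryQuadratic K) (hodd : Odd (NumberField.discr K))
    (_hsplit : ((Ideal.span {(p : ℤ)}).primesOver (𝓞 K)).ncard = 2)
    (h𝔭 : ((p : ℕ) : 𝓞 K) ∈ 𝔭.asIdeal)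
    (hι : ∀ (w' : InfinitePlace K) (k : 𝓞 K), k ∈ 𝔭.asIdeal ↔ ‖ι.symm (w'.embedding (k : K))‖ < 1)
    (hH : SatisfiesHeegnerHypothesis N K) (_hκ : κ.IsAnticyclotomic) (hγ : κ.IsTopGenerator γ)
    (hc : ¬ (p : ℤ) ∣ Dt.c)
    (hP : WeierstrassCurve.Affine.Point.map w.embedding.toRatAlgHom P = heegnerPointComplex Dt H)
    (he : ∀ k : 𝓞 K, k ∈ 𝔭.asIdeal ↔ ‖e (k : K)‖ < 1) :
    ∃ (ΩK : ℂ) (Ωp u : ℂ_[p]), ΩK ≠ 0 ∧ Ωp ≠ 0 ∧ ‖u‖ = 1 ∧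
      ∀ (φ : ℕ → HeckeCharacter K) (n : ℕ → ℕ) (r : ℕ → FramedGaloisRep K (PadicAlgCl p) 1),
        (∀ k, 0 < n k) → (∀ k (v : HeightOneSpectrum (𝓞 K)), (φ k).IsUnramifiedAt v) →
        (∀ k, (φ k).HasInfinityType (fun _ ↦ (n k : ℤ)) (fun _ ↦ -(n k : ℤ))) →
        (∀ k, IsPAdicAvatarOf ι (φ k) (r k)) → (∀ k, FactorsThroughZp κ (r k)) →
        Tendsto (fun k ↦ avatarValueAt (r k) γ) atTop (𝓝 1) →
        Tendsto (fun k ↦ ((ι.symm (bdpInterpolationValue p Dt.f 𝔭 (φ k) (n k) ΩK) :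
          PadicAlgCl p) : ℂ_[p]) * Ωp ^ (4 * n k)) atTop
          (𝓝 (u * (algebraMap ℚ_[p] ℂ_[p] (((1 : ℚ_[p]) - ((W.LFunction p : ℤ) : ℚ_[p]) *
            (p : ℚ_[p])⁻¹) * padicLogOmega W p e P)) ^ 2)) := by
  have hp : p.Prime := Fact.out
  have hp2 : p ≠ 2 := by omega
  have hN0 : N ≠ 0 := NeZero.ne N
  -- (i) the cyclic ideal `𝔑` of norm `N₀ = N/p` and an auxiliary pair `(𝔟, b_N)` prime to `N`
  set N₀ : ℕ := N / p with hN₀_def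
  have hNeq : N₀ * p = N := Nat.div_mul_cancel hpN
  have hN₀0 : N₀ ≠ 0 := fun h ↦ hN0 (by rw [← hNeq, h, zero_mul])
  have hN₀N : N₀ ∣ N := Nat.div_dvd_of_dvd hpN
  obtain ⟨𝔑, ⟨eN⟩⟩ := X11b.HeegnerIdeal.exists_ideal_quotient_ringEquiv_zmod_of_split_or_ramified
    (K := K) hK.1 hN₀0 (fun q hq hqN ↦ Or.inl (hH q hq (hqN.trans hN₀N)))
  have h𝔑0 : 𝔑 ≠ ⊥ := by
    intro h0
    have h := X11b.HeegnerIdeal.absNorm_eq_of_ringEquiv eN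
    rw [h0, Ideal.absNorm_bot] at h
    exact hN₀0 h.symm
  have hJ0 : Ideal.span {((N : ℕ) : 𝓞 K)} ≠ ⊥ := by
    rw [Ne, Ideal.span_singleton_eq_bot]; exact_mod_cast hN0
  obtain ⟨bN, 𝔟, hbN0, h𝔟𝔑, hcop⟩ := exists_mul_eq_span_and_isCoprime _ hJ0 𝔑 h𝔑0
  have h𝔟0 : 𝔟 ≠ ⊥ := by
    intro h0; rw [h0, Submodule.bot_mul] at h𝔟𝔑
    exact hbN0 (Ideal.span_singleton_eq_bot.mp h𝔟𝔑.symm)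
  have h𝔟p : ∀ v : HeightOneSpectrum (𝓞 K), v.asIdeal ∣ 𝔟 → ((p : ℕ) : 𝓞 K) ∉ v.asIdeal := by
    intro v hv hpv
    have hle : 𝔟 ≤ v.asIdeal := Ideal.le_of_dvd hv
    have hJle : Ideal.span {((N : ℕ) : 𝓞 K)} ≤ v.asIdeal := by
      rw [Ideal.span_singleton_le_iff_mem, ← hNeq, Nat.cast_mul]
      exact v.asIdeal.mul_mem_left _ hpv
    have htop : (⊤ : Ideal (𝓞 K)) ≤ v.asIdeal := by
      rw [← Ideal.isCoprime_iff_sup_eq.mp hcop]; exact sup_le hle hJle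
    exact v.isPrime.ne_top (top_le_iff.mp htop)
  -- (ii) the fact at this datum
  obtain ⟨wf, Ω, Ωp, u, hwf, hΩ, hΩp, hu, hlimB⟩ := hB ι W K 𝔭 Dt H w e P 𝔑 𝔟 bN hp5 hWN hpN hp2N
    hK hodd (hH p hp hpN) h𝔭 hι hH ⟨eN⟩ h𝔟0 hcop h𝔟𝔑 hc hP he
  -- the embedding `ι⁻¹ : ℂ → ℂ_p` as a ring map
  set em : ℂ →+* ℂ_[p] := (algebraMap (PadicAlgCl p) ℂ_[p]).comp ι.symm.toRingHom with hem
  have hem' : ∀ z : ℂ, ((ι.symm z : PadicAlgCl p) : ℂ_[p]) = em z := fun z ↦ rfl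
  -- (iii) the virtual complex period `Ω_K′`
  set bNc : ℂ := w.embedding ((bN : K)) with hbNc
  have hbNc0 : bNc ≠ 0 := by
    rw [hbNc, map_ne_zero]; exact_mod_cast hbN0
  set Nb : ℂ := ((Ideal.absNorm 𝔟 : ℕ) : ℂ) with hNb
  have hNb0 : Nb ≠ 0 := by
    rw [hNb, Nat.cast_ne_zero, Ne, Ideal.absNorm_eq_zero_iff]; exact h𝔟0
  have hN₀c : (N₀ : ℂ) ≠ 0 := by exact_mod_cast hN₀0
  have hd0 : ((|(NumberField.discr K : ℝ)| : ℝ) : ℂ) ≠ 0 := by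
    have h : (NumberField.discr K : ℝ) ≠ 0 := by exact_mod_cast NumberField.discr_ne_zero K
    exact_mod_cast (abs_ne_zero.mpr h)
  have hπ0 : (Real.pi : ℂ) ≠ 0 := by exact_mod_cast Real.pi_ne_zero
  set x : ℂ := Ω ^ 4 * Nb * (-(N₀ : ℂ)) * ((|(NumberField.discr K : ℝ)| : ℝ) : ℂ) /
    (4 * (Real.pi : ℂ) ^ 4 * bNc ^ 2) with hx
  have hx0 : x ≠ 0 := by
    rw [hx]
    exact div_ne_zero (mul_ne_zero (mul_ne_zero (mul_ne_zero (pow_ne_zero _ hΩ) hNb0)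
      (neg_ne_zero.mpr hN₀c)) hd0) (mul_ne_zero (mul_ne_zero (by norm_num) (pow_ne_zero _ hπ0))
      (pow_ne_zero _ hbNc0))
  obtain ⟨ΩK', hΩK'⟩ := IsAlgClosed.exists_pow_nat_eq x (by norm_num : 0 < 4)
  have hΩK'0 : ΩK' ≠ 0 := fun h0 ↦ hx0 (by rw [← hΩK', h0]; norm_num)
  -- (v) the constant `g = (1/4)·w_K·|d_K|^{1/2}·2^{#S(f)}` and the unit
  set sf : ℕ := ((N / p).gcd (NumberField.discr K).natAbs).primeFactors.card with hsf
  set g : ℂ := (1 / 4 : ℂ) * (Units.torsionOrder K : ℂ) * (Real.sqrt |(NumberField.discr K : ℝ)| : ℂ) *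
    (2 : ℂ) ^ sf with hg
  have hdisc : ¬ (p : ℤ) ∣ NumberField.discr K :=
    Literature.SatisfiesHeegnerHypothesis.not_dvd_discr hK.1 hH hp hpN
  have hwK : ¬ p ∣ Units.torsionOrder K := X11b.not_dvd_torsionOrder_of_finrank_le_two K hK.1.le hp hp5
  have hg1 : ‖em g‖ = 1 := by
    have h4 : ‖em (1 / 4 : ℂ)‖ = 1 := by
      rw [map_div₀, map_one, norm_div, norm_one, show (4 : ℂ) = ((4 : ℕ) : ℂ) by norm_num,
        norm_map_natCast_eq_one em (fun h ↦ ?_), div_one]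
      have : p ≤ 4 := Nat.le_of_dvd (by norm_num) h
      omega
    have h2 : ‖em ((2 : ℂ) ^ sf)‖ = 1 := by
      rw [map_pow, norm_pow, show (2 : ℂ) = ((2 : ℕ) : ℂ) by norm_num,
        norm_map_natCast_eq_one em (fun h ↦ ?_), one_pow]
      have : p ≤ 2 := Nat.le_of_dvd (by norm_num) h
      omega
    rw [hg, map_mul, map_mul, map_mul, norm_mul, norm_mul, norm_mul, h4,
      norm_map_natCast_eq_one em hwK, norm_map_sqrt_discr_eq_one em hdisc, h2]
    norm_num
  have hg0 : em g ≠ 0 := fun h ↦ by rw [h, norm_zero] at hg1; exact zero_ne_one hg1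
  have hwf1 : ‖em wf‖ = 1 := by
    rcases hwf with h | h <;> simp [h]
  have hwf0 : wf ≠ 0 := by rcases hwf with h | h <;> simp [h]
  -- the data
  set V : ℂ_[p] := algebraMap ℚ_[p] ℂ_[p] (((1 : ℚ_[p]) - ((W.LFunction p : ℤ) : ℚ_[p]) *
    (p : ℚ_[p])⁻¹) * padicLogOmega W p e P) with hV
  refine ⟨ΩK', Ωp, u ^ 2 * em wf * (em g)⁻¹, hΩK'0, hΩp, ?_, ?_⟩
  · rw [norm_mul, norm_mul, norm_inv, norm_pow, hu, hwf1, hg1]; norm_num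
  intro φ n r hn hunr htyp hav hfac hlimγ
  -- (ii') uniform convergence of the avatars, then the fact's limit and `φ_k(𝔟) → 1`
  have hunif : ∀ ε : ℝ, 0 < ε → ∀ᶠ k in atTop, ∀ σ : absoluteGaloisGroup K,
      ‖avatarValueAt (r k) σ - 1‖ < ε :=
    fun ε hε ↦ eventually_forall_norm_avatarValueAt_sub_one_lt hγ hfac hlimγ hε
  have hlim := hlimB φ n r hn hunr htyp hav hunif
  have hφb := tendsto_symm_heckeIdealValue ι hunr hav hunif h𝔟0 h𝔟p
  -- (iii') the display, term by term
  have hφb0 : ∀ k, heckeIdealValueExtZero (φ k) 𝔟 ≠ 0 := by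
    intro k
    rw [heckeIdealValueExtZero_eq_prod _ h𝔟0 (Ideal.finite_factors (show 𝔟 ≠ 0 from h𝔟0)).toFinset
      (fun v hv ↦ by rw [Set.Finite.mem_toFinset]; exact hv)]
    refine Finset.prod_ne_zero_iff.mpr fun v _ ↦ pow_ne_zero _ ?_
    rw [heckeValueExtZero_of_isUnramifiedAt (hunr k v), HeckeCharacter.valueAtUniformizer]
    exact Units.ne_zero _
  have hterm : ∀ k, ((ι.symm (bdpInterpolationValue p Dt.f 𝔭 (φ k) (n k) ΩK') : PadicAlgCl p) :
      ℂ_[p]) * Ωp ^ (4 * n k) =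
      bdpLp p ι Dt.f 𝔭 sf wf 𝔟 (N / p) bNc Ω Ωp (φ k) (n k) *
        (em wf * em (heckeIdealValueExtZero (φ k) 𝔟) * (em g)⁻¹) := by
    intro k
    have hres := eulerSq_mul_bdpLalg_eq hpN Dt.f 𝔭 sf wf 𝔟 (N / p) bNc Ω ΩK' (φ k) (hn k) hwf0
      (hφb0 k) hNb0 hN₀c hbNc0 hΩ (by rw [hΩK'])
    rw [← hg] at hres
    clear_value g
    rw [bdpLp_of_dvd ι hpN, hem', hem', hres, map_mul, map_div₀, map_mul em wf]
    have hφe : em (heckeIdealValueExtZero (φ k) 𝔟) ≠ 0 := (map_ne_zero em).mpr (hφb0 k)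
    have hwfe : em wf ≠ 0 := (map_ne_zero em).mpr hwf0
    have key : em g / (em wf * em (heckeIdealValueExtZero (φ k) 𝔟)) *
        (em wf * em (heckeIdealValueExtZero (φ k) 𝔟) * (em g)⁻¹) = 1 := by
      field_simp
    linear_combination (-(Ωp ^ (4 * n k) *
      em (bdpInterpolationValue p Dt.f 𝔭 (φ k) (n k) ΩK'))) * key
  simp_rw [hterm]
  -- the limit
  have hlim2 : Tendsto (fun k ↦ em wf * em (heckeIdealValueExtZero (φ k) 𝔟) * (em g)⁻¹) atTop
      (𝓝 (em wf * 1 * (em g)⁻¹)) :=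
    ((tendsto_const_nhds.mul (by simpa only [hem'] using hφb)).mul tendsto_const_nhds)
  have hfin := hlim.mul hlim2
  convert hfin using 2
  ring

end Main

end Summit.BirchSwinnertonDyer.Rank1Residual.X2

end
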